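import Literature.NumberTheory.LFunctions.Zhang2022.KnifeEdgeLenZDegreeBarrier

/-!
# Zhang (2022), rung F-S3 (Landau–Siegel programme, §D edge len = E*-len⁺): card `z-degree-toeplitz-band` —
# the 2×2 MINORS of the graded main matrix: one Cauchy–Schwarz violation of ONE named table on ONE in-class pair
# closes (`GradedCloses`), and the barrier horn `GradedPSD` forces exact Cauchy–Schwarz on every table (PROVED)

Y. Zhang, *Discrete mean estimates and the Landau–Siegel zero*, arXiv:2211.02515v1 [Zhang2022LandauSiegel] — an
unrefereed manuscript under adjudication. **WHAT THIS IS NOT: not a claim about Theorems 1–2 of arXiv:2211.02515,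
about Landau–Siegel zeros, or about Parity. The programme SEARCHES and TYPES; no claim about Landau–Siegel zeros,
Theorems 1–2 of arXiv:2211.02515 or a repaired Margin232 until a kernel theorem says so.** Everything here is
finite-dimensional algebra over the card's typed objects (`gradedMainMatrix`, `gradedQuadForm`, `GradedCloses`,
`GradedPSD`); no table is asserted.

WHY (cell landau-siegel §D, BIRTH (4); critic's C0 items α1–α3 2026-08-27T02:52:02Z/02:53:24Z, referee ls-ref-1's
α3 cell ALPHA3-CELL.md 593c89f6d240cf10 «λ_min over in-class triples»): once item α1 lands closed-form tables
`X₁^ψ, Y₁^ψ, X₂^ψ : PairFunctional`, the CHEAPEST α3 certificate is a single 2×2 minor: for ONE in-class pair, a certified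
Cauchy–Schwarz violation `|X₂^ψ(f,g₂)|² > 𝔅(f)·𝔅(g₂)` (resp. for `X₁^ψ` on `(f,g₁)`, `Y₁^ψ` on `(g₁,g₂)`) gives
`GradedCloses X₁^ψ Y₁^ψ X₂^ψ` (`gradedCloses_of_minor02/01/12`, amplitude vectors supported on two legs, the idle leg
carrying `g⋆`); conversely the barrier horn `GradedPSD` (graded B-AH⁺, registry E-014's «exact Cauchy–Schwarz persists»)
forces `|X(·,·)|² ≤ 𝔅·𝔅` for each of the three tables on every in-class pair (`normSq_le_of_gradedPSD_02/01/12`). The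
3×3 content proper (all minors PSD, determinant negative) is `gradedCloses_of_not_posSemidef` /
`gradedCloses_dark_of_schur` in the sibling files.

## References
* Y. Zhang, arXiv:2211.02515v1 (2022), §2 (2.16)–(2.17), §7 Prop. 7.1 (7.2). [cite: Zhang2022LandauSiegel, §2 (2.16)–(2.17), §7 Prop 7.1]
-/

noncomputable section

open Complex Real ComplexConjugate Matrix

namespace Literature.NumberTheory.LFunctions.Zhang2022.KnifeEdge

open Repair Skeleton

section Minors

variable {X₁ Y₁ X₂ : PairFunctional} {f f' g₁ g₁' g₂ g₂' : ℝ → ℂ}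

/-- **The graded quadratic form, expanded (pure algebra):**
`𝔅(f)|s₀|² + 𝔅(g₁)|s₁|² + 𝔅(g₂)|s₂|² + 2Re(s₀·conj(s₁X₁)) + 2Re(s₁·conj(s₂Y₁)) + 2Re(s₀·conj(s₂X₂))`.
[cite: Zhang2022LandauSiegel, §2 (2.16)–(2.17)] -/
theorem gradedQuadForm_eq (X₁ Y₁ X₂ : PairFunctional) (f f' g₁ g₁' g₂ g₂' : ℝ → ℂ) (s : Fin 3 → ℂ) :
    gradedQuadForm (gradedMainMatrix X₁ Y₁ X₂ f f' g₁ g₁' g₂ g₂') s =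
      mainTermForm f f' * ‖s 0‖ ^ 2 + mainTermForm g₁ g₁' * ‖s 1‖ ^ 2 + mainTermForm g₂ g₂' * ‖s 2‖ ^ 2
        + 2 * (s 0 * conj (s 1 * X₁ f f' g₁ g₁')).re + 2 * (s 1 * conj (s 2 * Y₁ g₁ g₁' g₂ g₂')).re
        + 2 * (s 0 * conj (s 2 * X₂ f f' g₂ g₂')).re := by
  simp only [gradedQuadForm, gradedMainMatrix, Fin.sum_univ_three, Matrix.of_apply, Matrix.cons_val',
    Matrix.cons_val_zero, Matrix.cons_val_one, Matrix.cons_val_two, Matrix.empty_val', Matrix.cons_val_fin_one,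
    Matrix.head_cons, Matrix.tail_cons, Matrix.head_fin_const]
  have h0 : ∀ z : ℂ, (z * conj z).re = ‖z‖ ^ 2 := fun z => by rw [Complex.mul_conj']; norm_cast
  have h1 : ∀ (z w : ℂ) (r : ℝ), (z * conj w * (r : ℂ)).re = r * (z * conj w).re := fun z w r => by
    rw [Complex.mul_re, Complex.ofReal_re, Complex.ofReal_im]; ring
  have h2 : ∀ z w u : ℂ, (z * conj w * conj u).re + (w * conj z * u).re = 2 * (z * conj (w * u)).re := by
    intro z w u
    have : w * conj z * u = conj (z * conj w * conj u) := by
      rw [map_mul, map_mul, Complex.conj_conj, Complex.conj_conj]; ring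
    rw [this, Complex.conj_re, map_mul]; ring
  simp only [Complex.add_re, h1, h0]
  have e1 := h2 (s 0) (s 1) (X₁ f f' g₁ g₁')
  have e2 := h2 (s 1) (s 2) (Y₁ g₁ g₁' g₂ g₂')
  have e3 := h2 (s 0) (s 2) (X₂ f f' g₂ g₂')
  linarith [e1, e2, e3]

/-- The generic 2×2 step (pure algebra): for `a ≥ 0`, any real `b` and `z` with `a·b < |z|²`, the binary form
`a|u|² + b|v|² + 2Re(u·conj(v·z))` takes a negative value (at `v = 1`, `u = −r·z` with `r = 1/a`, or `r` large if
`a = 0`). [folklore] -/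
private theorem binary_form_neg {a b : ℝ} (ha : 0 ≤ a) {z : ℂ} (h : a * b < ‖z‖ ^ 2) :
    ∃ u v : ℂ, a * ‖u‖ ^ 2 + b * ‖v‖ ^ 2 + 2 * (u * conj (v * z)).re < 0 := by
  by_cases hz0 : z = 0
  · -- then `a·b < 0`, so `b < 0`: the vector `(0, 1)` has value `b`
    subst hz0
    have hb : b < 0 := by
      rw [norm_zero] at h
      by_contra hb
      have : 0 ≤ a * b := mul_nonneg ha (not_lt.mp hb)
      linarith
    exact ⟨0, 1, by simpa using hb⟩
  have hz : 0 < ‖z‖ ^ 2 := by positivity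
  -- the value at (u, v) = (-r z, 1)
  have key : ∀ r : ℝ, a * ‖(-(r : ℂ) * z)‖ ^ 2 + b * ‖(1 : ℂ)‖ ^ 2 + 2 * ((-(r : ℂ) * z) * conj ((1 : ℂ) * z)).re =
      a * r ^ 2 * ‖z‖ ^ 2 + b - 2 * r * ‖z‖ ^ 2 := by
    intro r
    have hre : ((-(r : ℂ) * z) * conj ((1 : ℂ) * z)).re = -(r * ‖z‖ ^ 2) := by
      rw [one_mul, mul_assoc, Complex.mul_conj', neg_mul, Complex.neg_re]
      norm_cast
    rw [hre, norm_mul, norm_neg, Complex.norm_real, Real.norm_eq_abs, mul_pow, sq_abs, norm_one]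
    ring
  rcases eq_or_lt_of_le ha with rfl | ha'
  · -- a = 0: take r large
    refine ⟨-(((|b| + 1) / ‖z‖ ^ 2 : ℝ) : ℂ) * z, 1, ?_⟩
    rw [key]
    have : 2 * ((|b| + 1) / ‖z‖ ^ 2) * ‖z‖ ^ 2 = 2 * (|b| + 1) := by field_simp
    rw [this]
    simp only [zero_mul, zero_add]
    linarith [le_abs_self b, abs_nonneg b]
  · refine ⟨-(((1 / a : ℝ)) : ℂ) * z, 1, ?_⟩
    rw [key]
    have e : a * (1 / a) ^ 2 * ‖z‖ ^ 2 + b - 2 * (1 / a) * ‖z‖ ^ 2 = b - ‖z‖ ^ 2 / a := by field_simp; ring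
    rw [e]
    have hb : b < ‖z‖ ^ 2 / a := by rw [lt_div_iff₀ ha']; linarith [mul_comm a b]
    linarith

/-- **One 2×2 minor closes — the NEW table (proved):** if for ONE in-class pair `(f, g₂)` the degree-2 table violates
Cauchy–Schwarz against the main-term form, `𝔅(f)·𝔅(g₂) < |X₂(f,g₂)|²`, then `GradedCloses X₁ Y₁ X₂` — amplitudes
`(u, 0, v)` on legs 0 and 2 (leg 1 idle, carrying `g⋆`), whatever `X₁, Y₁` are. The cheapest α3 certificate.
[cite: Zhang2022LandauSiegel, §2 (2.16), §7 Prop 7.1 (7.2)] -/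
theorem gradedCloses_of_minor02 (hf : InClassPiece f f') (hg₂ : InClassPiece g₂ g₂')
    (h : mainTermForm f f' * mainTermForm g₂ g₂' < ‖X₂ f f' g₂ g₂'‖ ^ 2) : GradedCloses X₁ Y₁ X₂ := by
  obtain ⟨u, v, huv⟩ := binary_form_neg (mainTermForm_nonneg_of_isH1 hf.kinked.isH1) h
  refine ⟨f, f', gStar, gStar', g₂, g₂', ![u, 0, v], hf, inClassPiece_gStar, hg₂, ?_⟩
  rw [gradedQuadForm_eq]
  simp only [Matrix.cons_val_zero, Matrix.cons_val_one, Matrix.head_cons, Matrix.cons_val_two, Matrix.tail_cons,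
    norm_zero, zero_mul, mul_zero, map_zero, Complex.zero_re, add_zero, map_mul]
  simpa [map_mul] using huv

/-- **One 2×2 minor closes — the degree-1 cross table (proved):** `𝔅(f)·𝔅(g₁) < |X₁(f,g₁)|²` on one in-class pair ⇒
`GradedCloses X₁ Y₁ X₂` (amplitudes on legs 0, 1; leg 2 idle). [cite: Zhang2022LandauSiegel, §2 (2.16), §7 Prop 7.1 (7.2)] -/
theorem gradedCloses_of_minor01 (hf : InClassPiece f f') (hg₁ : InClassPiece g₁ g₁')
    (h : mainTermForm f f' * mainTermForm g₁ g₁' < ‖X₁ f f' g₁ g₁'‖ ^ 2) : GradedCloses X₁ Y₁ X₂ := by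
  obtain ⟨u, v, huv⟩ := binary_form_neg (mainTermForm_nonneg_of_isH1 hf.kinked.isH1) h
  refine ⟨f, f', g₁, g₁', gStar, gStar', ![u, v, 0], hf, hg₁, inClassPiece_gStar, ?_⟩
  rw [gradedQuadForm_eq]
  simp only [Matrix.cons_val_zero, Matrix.cons_val_one, Matrix.head_cons, Matrix.cons_val_two, Matrix.tail_cons,
    norm_zero, zero_mul, mul_zero, map_zero, Complex.zero_re, add_zero, map_mul]
  simpa [map_mul] using huv

/-- **One 2×2 minor closes — the dual table (proved):** `𝔅(g₁)·𝔅(g₂) < |Y₁(g₁,g₂)|²` on one in-class pair ⇒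
`GradedCloses X₁ Y₁ X₂` (amplitudes on legs 1, 2; leg 0 idle). [cite: Zhang2022LandauSiegel, §2 (2.16)–(2.17), §7 Prop 7.1 (7.2)] -/
theorem gradedCloses_of_minor12 (hg₁ : InClassPiece g₁ g₁') (hg₂ : InClassPiece g₂ g₂')
    (h : mainTermForm g₁ g₁' * mainTermForm g₂ g₂' < ‖Y₁ g₁ g₁' g₂ g₂'‖ ^ 2) : GradedCloses X₁ Y₁ X₂ := by
  obtain ⟨u, v, huv⟩ := binary_form_neg (mainTermForm_nonneg_of_isH1 hg₁.kinked.isH1) h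
  refine ⟨gStar, gStar', g₁, g₁', g₂, g₂', ![0, u, v], inClassPiece_gStar, hg₁, hg₂, ?_⟩
  rw [gradedQuadForm_eq]
  simp only [Matrix.cons_val_zero, Matrix.cons_val_one, Matrix.head_cons, Matrix.cons_val_two, Matrix.tail_cons,
    norm_zero, zero_mul, mul_zero, Complex.zero_re, add_zero, map_mul]
  simpa [map_mul] using huv

/-- **The barrier horn forces exact Cauchy–Schwarz on the NEW table (proved; E-014's shape for the graded tables):**
`GradedPSD X₁ Y₁ X₂` ⇒ `|X₂(f,g₂)|² ≤ 𝔅(f)·𝔅(g₂)` for every in-class pair. [cite: Zhang2022LandauSiegel, §2 (2.16)] -/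
theorem normSq_le_of_gradedPSD_02 (hP : GradedPSD X₁ Y₁ X₂) (hf : InClassPiece f f') (hg₂ : InClassPiece g₂ g₂') :
    ‖X₂ f f' g₂ g₂'‖ ^ 2 ≤ mainTermForm f f' * mainTermForm g₂ g₂' :=
  not_lt.mp fun h => not_gradedCloses_of_gradedPSD hP (gradedCloses_of_minor02 hf hg₂ h)

/-- … on the degree-1 cross table: `GradedPSD` ⇒ `|X₁(f,g₁)|² ≤ 𝔅(f)·𝔅(g₁)`. [cite: Zhang2022LandauSiegel, §2 (2.16)] -/
theorem normSq_le_of_gradedPSD_01 (hP : GradedPSD X₁ Y₁ X₂) (hf : InClassPiece f f') (hg₁ : InClassPiece g₁ g₁') :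
    ‖X₁ f f' g₁ g₁'‖ ^ 2 ≤ mainTermForm f f' * mainTermForm g₁ g₁' :=
  not_lt.mp fun h => not_gradedCloses_of_gradedPSD hP (gradedCloses_of_minor01 hf hg₁ h)

/-- … on the dual table: `GradedPSD` ⇒ `|Y₁(g₁,g₂)|² ≤ 𝔅(g₁)·𝔅(g₂)`. [cite: Zhang2022LandauSiegel, §2 (2.16)–(2.17)] -/
theorem normSq_le_of_gradedPSD_12 (hP : GradedPSD X₁ Y₁ X₂) (hg₁ : InClassPiece g₁ g₁') (hg₂ : InClassPiece g₂ g₂') :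
    ‖Y₁ g₁ g₁' g₂ g₂'‖ ^ 2 ≤ mainTermForm g₁ g₁' * mainTermForm g₂ g₂' :=
  not_lt.mp fun h => not_gradedCloses_of_gradedPSD hP (gradedCloses_of_minor12 hg₁ hg₂ h)

/-- **Kernel pieces are dark for every table under the barrier (proved):** if `𝔅(f) = 0` for an in-class `f` (a
kernel direction of Zhang's form), `GradedPSD` forces `X₁(f,·) = 0` and `X₂(f,·) = 0` on all in-class partners — the
model's prediction, now for the degree-2 table too (cf. `dualTable_eq_zero_of_gradedPSD_dark`). [cite: Zhang2022LandauSiegel, §2 (2.16), §7 Prop 7.1] -/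
theorem tables_eq_zero_of_gradedPSD_kernel (hP : GradedPSD X₁ Y₁ X₂) (hf : InClassPiece f f')
    (hB : mainTermForm f f' = 0) (hg₁ : InClassPiece g₁ g₁') (hg₂ : InClassPiece g₂ g₂') :
    X₁ f f' g₁ g₁' = 0 ∧ X₂ f f' g₂ g₂' = 0 := by
  have h1 := normSq_le_of_gradedPSD_01 hP hf hg₁
  have h2 := normSq_le_of_gradedPSD_02 hP hf hg₂
  rw [hB, zero_mul] at h1 h2
  exact ⟨norm_eq_zero.mp (by nlinarith [norm_nonneg (X₁ f f' g₁ g₁')]),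
    norm_eq_zero.mp (by nlinarith [norm_nonneg (X₂ f f' g₂ g₂')])⟩

end Minors

/-! ### Part 2 — TRANSFER on the (A)-infinitely-often horn (the birth skeleton's `stub_transfer` of crux
`PsiGradedTablesClose`, route `ZDegreeToeplitzBand`, PACKET 2026-08-27T03:19:37Z): two triples filling the same three ψ-graded
slots agree on in-class pieces (`crossTablePsi_unique` / `dualCrossTablePsi_unique`), and `GradedCloses` / `GradedPSD` evaluate
the functionals at in-class pieces only — so both transfer. PROVED; the stub becomes a one-line citation. -/

section Transfer

variable {c' : ℝ} {X₁ Y₁ X₂ X₁' Y₁' X₂' : PairFunctional} {f f' g₁ g₁' g₂ g₂' : ℝ → ℂ}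

/-- The graded main matrix depends on the functionals only through their three values on the triple (congruence).
[cite: Zhang2022LandauSiegel, §2 (2.16)–(2.17)] -/
theorem gradedMainMatrix_congr (e1 : X₁ f f' g₁ g₁' = X₁' f f' g₁ g₁') (e2 : Y₁ g₁ g₁' g₂ g₂' = Y₁' g₁ g₁' g₂ g₂')
    (e3 : X₂ f f' g₂ g₂' = X₂' f f' g₂ g₂') :
    gradedMainMatrix X₁ Y₁ X₂ f f' g₁ g₁' g₂ g₂' = gradedMainMatrix X₁' Y₁' X₂' f f' g₁ g₁' g₂ g₂' := by
  simp only [gradedMainMatrix, e1, e2, e3]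

/-- **`GradedCloses` transfers between slot-witnesses on the (A)-i.o. horn (proved; = `stub_transfer`):** if (A) holds
infinitely often, two triples `(X₁,Y₁,X₂)`, `(X₁′,Y₁′,X₂′)` filling the degree-1 cross, degree-1 dual and degree-2 slots at the
same `c′` take the same values on every in-class triple, so a closing design for one closes for the other.
[cite: Zhang2022LandauSiegel, §2 (2.16), §8 (8.5)] -/
theorem gradedCloses_transfer (hA : ¬ ForAllLarge fun D _ χ => ¬ AssumptionA D χ)
    (h1 : CrossTablePsi c' 1 X₁) (h21 : DualCrossTablePsi c' 1 Y₁) (h2 : TauTwoTablePsi c' X₂)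
    (h1' : CrossTablePsi c' 1 X₁') (h21' : DualCrossTablePsi c' 1 Y₁') (h2' : TauTwoTablePsi c' X₂')
    (hC : GradedCloses X₁ Y₁ X₂) : GradedCloses X₁' Y₁' X₂' := by
  obtain ⟨f, f', g₁, g₁', g₂, g₂', s, hf, hg₁, hg₂, hneg⟩ := hC
  refine ⟨f, f', g₁, g₁', g₂, g₂', s, hf, hg₁, hg₂, ?_⟩
  rwa [← gradedMainMatrix_congr (crossTablePsi_unique h1 h1' hA hf hg₁) (dualCrossTablePsi_unique h21 h21' hA hg₁ hg₂)
    (crossTablePsi_unique h2 h2' hA hf hg₂)]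

/-- … and so does the barrier horn `GradedPSD`. [cite: Zhang2022LandauSiegel, §2 (2.16), §8 (8.5)] -/
theorem gradedPSD_transfer (hA : ¬ ForAllLarge fun D _ χ => ¬ AssumptionA D χ)
    (h1 : CrossTablePsi c' 1 X₁) (h21 : DualCrossTablePsi c' 1 Y₁) (h2 : TauTwoTablePsi c' X₂)
    (h1' : CrossTablePsi c' 1 X₁') (h21' : DualCrossTablePsi c' 1 Y₁') (h2' : TauTwoTablePsi c' X₂')
    (hP : GradedPSD X₁ Y₁ X₂) : GradedPSD X₁' Y₁' X₂' :=
  gradedPSD_of_not_gradedCloses fun hC' =>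
    not_gradedCloses_of_gradedPSD hP (gradedCloses_transfer hA h1' h21' h2' h1 h21 h2 hC')

/-- **The route's `stub_transfer`, verbatim shape (proved).** [cite: Zhang2022LandauSiegel, §2 (2.16), §8 (8.5)] -/
theorem gradedCloses_transfer_all :
    (¬ ForAllLarge fun D _ χ => ¬ AssumptionA D χ) →
      ∀ c' : ℝ, ∀ X₁ Y₁ X₂ X₁' Y₁' X₂' : PairFunctional,
        CrossTablePsi c' 1 X₁ → DualCrossTablePsi c' 1 Y₁ → TauTwoTablePsi c' X₂ →
        CrossTablePsi c' 1 X₁' → DualCrossTablePsi c' 1 Y₁' → TauTwoTablePsi c' X₂' →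
        GradedCloses X₁ Y₁ X₂ → GradedCloses X₁' Y₁' X₂' :=
  fun hA _ _ _ _ _ _ _ h1 h21 h2 h1' h21' h2' hC => gradedCloses_transfer hA h1 h21 h2 h1' h21' h2' hC

/-- **Consequence for crux K2 (proved): ONE closing slot-witness for all large `c′` gives `PsiGradedTablesClose`'s content** —
on the (A)-i.o. horn, `∃ c₀, ∃ (X₁,Y₁,X₂), (∀ c' ≥ c₀, slots) ∧ GradedCloses X₁ Y₁ X₂` implies that EVERY slot-witness at every
`c′ ≥ c₀` closes (the birth skeleton's `PsiGradedTablesClose_of` with `stub_transfer` discharged). [cite: Zhang2022LandauSiegel, §2 (2.16)] -/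
theorem forall_witness_closes_of_candidate (hA : ¬ ForAllLarge fun D _ χ => ¬ AssumptionA D χ) {c₀ : ℝ}
    (hT : ∀ c' : ℝ, c₀ ≤ c' → CrossTablePsi c' 1 X₁ ∧ DualCrossTablePsi c' 1 Y₁ ∧ TauTwoTablePsi c' X₂)
    (hC : GradedCloses X₁ Y₁ X₂) :
    ∀ c' : ℝ, c₀ ≤ c' → ∀ X₁' Y₁' X₂' : PairFunctional,
      CrossTablePsi c' 1 X₁' → DualCrossTablePsi c' 1 Y₁' → TauTwoTablePsi c' X₂' → GradedCloses X₁' Y₁' X₂' := by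
  intro c' hc' X₁' Y₁' X₂' t1 t21 t2
  obtain ⟨s1, s21, s2⟩ := hT c' hc'
  exact gradedCloses_transfer hA s1 s21 s2 t1 t21 t2 hC

end Transfer

/-! ### Part 3 — HOMOGENEOUS tables pass the α1 junk guard for free: a pair functional that is homogeneous in the first
piece and conjugate-homogeneous in the second (the shape of `OffDiagForm.smul_left/smul_right`, of `Repair.MformTop θ`, and of
every sesquilinear profile integral the census can produce) vanishes on the zero profile (`VanishesOnZero`, Barrier Part 6). -/

section Homogeneous

/-- **Pair-homogeneity (shape):** `X(c•a, c•a′; b, b′) = c·X(a,a′;b,b′)` and `X(a,a′; c•b, c•b′) = conj c·X(a,a′;b,b′)` — the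
two homogeneity fields of `OffDiagForm` without its `below_wall` clause; the item-α1 tables `X₁^ψ, Y₁^ψ, X₂^ψ` are to be of
this shape (sesquilinear profile integrals). [cite: Zhang2022LandauSiegel, §7 Prop 7.1 (7.2)] -/
def PairHomogeneous (X : PairFunctional) : Prop :=
  (∀ (c : ℂ) (a a' b b' : ℝ → ℂ), X (c • a) (c • a') b b' = c * X a a' b b') ∧
    ∀ (c : ℂ) (a a' b b' : ℝ → ℂ), X a a' (c • b) (c • b') = conj c * X a a' b b'

/-- **Homogeneous ⇒ passes the junk guard (proved):** take `c = 0` on either leg. So a closed-form table given as a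
sesquilinear integral needs no separate `VanishesOnZero` check. [cite: Zhang2022LandauSiegel, §7 Prop 7.1 (7.2)] -/
theorem vanishesOnZero_of_pairHomogeneous {X : PairFunctional} (h : PairHomogeneous X) : VanishesOnZero X := by
  refine ⟨fun g g' => ?_, fun f f' => ?_⟩
  · have := h.1 0 (fun _ => 0) (fun _ => 0) g g'
    simp only [zero_smul, zero_mul] at this
    exact this
  · have := h.2 0 f f' (fun _ => 0) (fun _ => 0)
    simp only [zero_smul, map_zero, zero_mul] at this
    exact this

/-- An `OffDiagForm θ X` (the len cards' off-diagonal input shape, `KnifeEdgeOffDiagForm`) is pair-homogeneous, hence guarded.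
[cite: Zhang2022LandauSiegel, §7 Prop 7.1 (7.2)] -/
theorem pairHomogeneous_of_offDiagForm {θ : ℝ} {X : PairFunctional} (h : OffDiagForm θ X) : PairHomogeneous X :=
  ⟨h.smul_left, h.smul_right⟩

/-- The zero table is pair-homogeneous. [cite: Zhang2022LandauSiegel, §7 Prop 7.1 (7.2)] -/
theorem pairHomogeneous_zero : PairHomogeneous 0 := ⟨fun _ _ _ _ _ => by simp, fun _ _ _ _ _ => by simp⟩

/-- The junk table `1` is not pair-homogeneous (consistent with `not_vanishesOnZero_junk_table`). [cite: Zhang2022LandauSiegel, §7 Prop 7.1 (7.2)] -/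
theorem not_pairHomogeneous_junk_table : ¬ PairHomogeneous (fun _ _ _ _ => (1 : ℂ)) :=
  fun h => not_vanishesOnZero_junk_table (vanishesOnZero_of_pairHomogeneous h)

end Homogeneous

/-! ### Part 4 — the KERNEL-ROW certificate (critic ls-knife-crit-1 g3, proposed ALPHA3-CELL stage S0, 2026-08-27T03:55:18Z):
on a kernel mode of Zhang's form (`𝔅(f) = 0`, e.g. `f = g⋆`, `Repair.mainTermForm_gStar`) the 2×2 minors degenerate — ONE non-zero
value of a table against that row closes; conversely the pinned / PSD tables vanish there (`tables_eq_zero_of_gradedPSD_kernel`) -/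

section KernelRow

variable {X₁ Y₁ X₂ : PairFunctional} {f f' g₁ g₁' g₂ g₂' : ℝ → ℂ}

/-- **Kernel row, degree-2 table (proved):** `𝔅(f) = 0` for an in-class `f` and `X₂(f,g₂) ≠ 0` for one in-class `g₂` ⇒
`GradedCloses X₁ Y₁ X₂` (`gradedCloses_of_minor02` with a vanishing product of main forms). [cite: Zhang2022LandauSiegel, §2 (2.16), §7 Prop 7.1 (7.2)] -/
theorem gradedCloses_of_kernelRow02 (hf : InClassPiece f f') (hB : mainTermForm f f' = 0) (hg₂ : InClassPiece g₂ g₂')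
    (hX : X₂ f f' g₂ g₂' ≠ 0) : GradedCloses X₁ Y₁ X₂ :=
  gradedCloses_of_minor02 hf hg₂ (by rw [hB, zero_mul]; exact pow_pos (norm_pos_iff.mpr hX) 2)

/-- **Kernel row, degree-1 cross table (proved):** `𝔅(f) = 0`, `X₁(f,g₁) ≠ 0` ⇒ `GradedCloses`. [cite: Zhang2022LandauSiegel, §2 (2.16), §7 Prop 7.1 (7.2)] -/
theorem gradedCloses_of_kernelRow01 (hf : InClassPiece f f') (hB : mainTermForm f f' = 0) (hg₁ : InClassPiece g₁ g₁')
    (hX : X₁ f f' g₁ g₁' ≠ 0) : GradedCloses X₁ Y₁ X₂ :=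
  gradedCloses_of_minor01 hf hg₁ (by rw [hB, zero_mul]; exact pow_pos (norm_pos_iff.mpr hX) 2)

/-- **Kernel row, dual table (proved):** `𝔅(g₁) = 0`, `Y₁(g₁,g₂) ≠ 0` ⇒ `GradedCloses`. [cite: Zhang2022LandauSiegel, §2 (2.16)–(2.17), §7 Prop 7.1 (7.2)] -/
theorem gradedCloses_of_kernelRow12 (hg₁ : InClassPiece g₁ g₁') (hB : mainTermForm g₁ g₁' = 0) (hg₂ : InClassPiece g₂ g₂')
    (hY : Y₁ g₁ g₁' g₂ g₂' ≠ 0) : GradedCloses X₁ Y₁ X₂ :=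
  gradedCloses_of_minor12 hg₁ hg₂ (by rw [hB, zero_mul]; exact pow_pos (norm_pos_iff.mpr hY) 2)

/-- **S0 with Zhang's own kernel mode `g⋆` (proved):** `X₂(g⋆, g₂) ≠ 0` for ONE in-class `g₂` ⇒ `GradedCloses X₁ Y₁ X₂` — the
cheapest conceivable α3 certificate (`Repair.mainTermForm_gStar : 𝔅(g⋆) = 0`, `inClassPiece_gStar`); and the same for `X₁`.
Model side: pinned/PSD tables vanish on this row (`tables_eq_zero_of_gradedPSD_kernel`), so Zhang-consistent closed forms are
expected to give `X₁(g⋆,·) = X₂(g⋆,·) = 0` identically — an identity check on the α1 defs. [cite: Zhang2022LandauSiegel, §2 (2.16), §7 Prop 7.1 p.44 (7.2)] -/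
theorem gradedCloses_of_gStar_row (hg₂ : InClassPiece g₂ g₂') (hX : X₂ gStar gStar' g₂ g₂' ≠ 0) : GradedCloses X₁ Y₁ X₂ :=
  gradedCloses_of_kernelRow02 inClassPiece_gStar mainTermForm_gStar hg₂ hX

/-- … degree-1 version. [cite: Zhang2022LandauSiegel, §2 (2.16), §7 Prop 7.1 p.44 (7.2)] -/
theorem gradedCloses_of_gStar_row₁ (hg₁ : InClassPiece g₁ g₁') (hX : X₁ gStar gStar' g₁ g₁' ≠ 0) : GradedCloses X₁ Y₁ X₂ :=
  gradedCloses_of_kernelRow01 inClassPiece_gStar mainTermForm_gStar hg₁ hX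

/-- **The barrier reading of S0 (proved):** under `GradedPSD`, every table vanishes on the `g⋆` row/column —
`X₁(g⋆,g₁) = 0`, `X₂(g⋆,g₂) = 0` for all in-class partners. [cite: Zhang2022LandauSiegel, §2 (2.16), §7 Prop 7.1 p.44 (7.2)] -/
theorem tables_eq_zero_on_gStar_of_gradedPSD (hP : GradedPSD X₁ Y₁ X₂) (hg₁ : InClassPiece g₁ g₁') (hg₂ : InClassPiece g₂ g₂') :
    X₁ gStar gStar' g₁ g₁' = 0 ∧ X₂ gStar gStar' g₂ g₂' = 0 :=
  tables_eq_zero_of_gradedPSD_kernel hP inClassPiece_gStar mainTermForm_gStar hg₁ hg₂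

end KernelRow

/-! ### Part 5 — kernel COLUMNS and the SWITCH (critic ls-knife-crit-1 g3 04:06:25Z/04:08:27Z probe `KernelRow-ZDegreeToeplitzBand.lean`
3f3d7e014f1ff338 folded in; referee ls-ref-1 ALPHA3-CELL v0.4 ea96315632818a9d stage S0′): the `g⋆` mode in the SECOND leg of each table,
and «one live kernel entry ⇒ `GradedCloses ∧ ¬ GradedPSD`» — the instant switch between the closing horn and the Gram/PSD horn -/

section KernelCol

variable {X₁ Y₁ X₂ : PairFunctional} {f f' g₁ g₁' g₂ g₂' : ℝ → ℂ}

/-- **Kernel column, degree-2 table:** `X₂(f, g⋆) ≠ 0` for one in-class `f` ⇒ `GradedCloses` (`𝔅(g⋆) = 0` kills the product in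
`gradedCloses_of_minor02`). [cite: Zhang2022LandauSiegel, §2 (2.16), §7 Prop 7.1 p.44 (7.2)] -/
theorem gradedCloses_of_gStar_col (hf : InClassPiece f f') (hX : X₂ f f' gStar gStar' ≠ 0) : GradedCloses X₁ Y₁ X₂ :=
  gradedCloses_of_minor02 hf inClassPiece_gStar
    (by rw [mainTermForm_gStar, mul_zero]; exact pow_pos (norm_pos_iff.mpr hX) 2)

/-- **Kernel column, degree-1 cross table:** `X₁(f, g⋆) ≠ 0` ⇒ `GradedCloses`. [cite: Zhang2022LandauSiegel, §2 (2.16), §7 Prop 7.1 p.44 (7.2)] -/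
theorem gradedCloses_of_gStar_col₁ (hf : InClassPiece f f') (hX : X₁ f f' gStar gStar' ≠ 0) : GradedCloses X₁ Y₁ X₂ :=
  gradedCloses_of_minor01 hf inClassPiece_gStar
    (by rw [mainTermForm_gStar, mul_zero]; exact pow_pos (norm_pos_iff.mpr hX) 2)

/-- **Kernel mode in the dual table, either leg:** `Y₁(g⋆, g₂) ≠ 0` or `Y₁(g₁, g⋆) ≠ 0` for one in-class partner ⇒ `GradedCloses`.
[cite: Zhang2022LandauSiegel, §2 (2.16)–(2.17), §7 Prop 7.1 p.44 (7.2)] -/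
theorem gradedCloses_of_gStar_dual (hg₂ : InClassPiece g₂ g₂') (hY : Y₁ gStar gStar' g₂ g₂' ≠ 0) : GradedCloses X₁ Y₁ X₂ :=
  gradedCloses_of_kernelRow12 inClassPiece_gStar mainTermForm_gStar hg₂ hY

/-- … second leg. [cite: Zhang2022LandauSiegel, §2 (2.16)–(2.17), §7 Prop 7.1 p.44 (7.2)] -/
theorem gradedCloses_of_gStar_dual' (hg₁ : InClassPiece g₁ g₁') (hY : Y₁ g₁ g₁' gStar gStar' ≠ 0) : GradedCloses X₁ Y₁ X₂ :=
  gradedCloses_of_minor12 hg₁ inClassPiece_gStar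
    (by rw [mainTermForm_gStar, mul_zero]; exact pow_pos (norm_pos_iff.mpr hY) 2)

/-- **THE KERNEL-ROW SWITCH (proved):** one non-zero value of the degree-2 table on the `g⋆` row decides BOTH horns at once —
`GradedCloses X₁ Y₁ X₂` holds and the barrier twin `GradedPSD X₁ Y₁ X₂` fails (so no Gram certificate `gradedPSD_of_gram` can exist).
Stage S0′ of the referee's α3 cell. [cite: Zhang2022LandauSiegel, §2 (2.16), §7 Prop 7.1 p.44 (7.2)] -/
theorem kernelRow_switch (hg₂ : InClassPiece g₂ g₂') (hX : X₂ gStar gStar' g₂ g₂' ≠ 0) :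
    GradedCloses X₁ Y₁ X₂ ∧ ¬ GradedPSD X₁ Y₁ X₂ :=
  ⟨gradedCloses_of_gStar_row hg₂ hX, fun hP => hX (tables_eq_zero_on_gStar_of_gradedPSD hP inClassPiece_gStar hg₂).2⟩

/-- … and the degree-1 switch. [cite: Zhang2022LandauSiegel, §2 (2.16), §7 Prop 7.1 p.44 (7.2)] -/
theorem kernelRow_switch₁ (hg₁ : InClassPiece g₁ g₁') (hX : X₁ gStar gStar' g₁ g₁' ≠ 0) :
    GradedCloses X₁ Y₁ X₂ ∧ ¬ GradedPSD X₁ Y₁ X₂ :=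
  ⟨gradedCloses_of_gStar_row₁ hg₁ hX, fun hP => hX (tables_eq_zero_on_gStar_of_gradedPSD hP hg₁ inClassPiece_gStar).1⟩

end KernelCol

/-! ### Part 6 — the TRUE tables are dark on the `g⋆` row unless (A) fails eventually (proved): slots ∧ (A) infinitely often ⇒
`X₁(g⋆,·) = X₂(g⋆,·) = 0` on in-class partners (`gradedPSD_of_slots_of_notA_io` ∘ `tables_eq_zero_on_gStar_of_gradedPSD`). So a census
formula with a LIVE `g⋆` row that also satisfies its slot gives «(A) fails eventually» — the closing horn — by `kernelRow_switch`. -/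

section TrueTablesKernelRow

variable {c' : ℝ} {X₁ Y₁ X₂ : PairFunctional} {g₁ g₁' g₂ g₂' : ℝ → ℂ}

/-- **Slot-satisfying tables vanish on Zhang's kernel mode, on the (A)-i.o. horn (proved).** [cite: Zhang2022LandauSiegel, §2 (2.16), §7 Prop 7.1 p.44 (7.2), §8 (8.5)] -/
theorem tables_eq_zero_on_gStar_of_slots (h0 : InClassMean c') (h22 : Prop22i) (h23 : Lemma23 c')
    (h1 : CrossTablePsi c' 1 X₁) (h21 : DualCrossTablePsi c' 1 Y₁) (h2 : TauTwoTablePsi c' X₂)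
    (hA : ¬ ForAllLarge fun D _ χ => ¬ AssumptionA D χ) (hg₁ : InClassPiece g₁ g₁') (hg₂ : InClassPiece g₂ g₂') :
    X₁ gStar gStar' g₁ g₁' = 0 ∧ X₂ gStar gStar' g₂ g₂' = 0 :=
  tables_eq_zero_on_gStar_of_gradedPSD (gradedPSD_of_slots_of_notA_io h0 h22 h23 h1 h21 h2 hA) hg₁ hg₂

/-- **Contrapositive: a live `g⋆` row of a slot-satisfying degree-2 table forces «(A) fails eventually»** (hence `Theorem1`,
`Skeleton.theorem1_of_eventually_not_assumptionA`) — the kernel-row switch read against the true tables.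
[cite: Zhang2022LandauSiegel, §2 p. 6, (2.16), §8 (8.5)] -/
theorem notAEventually_of_live_gStar_row (h0 : InClassMean c') (h22 : Prop22i) (h23 : Lemma23 c')
    (h1 : CrossTablePsi c' 1 X₁) (h21 : DualCrossTablePsi c' 1 Y₁) (h2 : TauTwoTablePsi c' X₂)
    (hg₂ : InClassPiece g₂ g₂') (hX : X₂ gStar gStar' g₂ g₂' ≠ 0) :
    ForAllLarge fun D _ χ => ¬ AssumptionA D χ := by
  by_contra hA
  exact hX (tables_eq_zero_on_gStar_of_slots h0 h22 h23 h1 h21 h2 hA inClassPiece_gStar hg₂).2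

end TrueTablesKernelRow

end Literature.NumberTheory.LFunctions.Zhang2022.KnifeEdge

end
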